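import Literature.NumberTheory.LFunctions.TaoLogChowlaOfTheoremA2
import HarnessLib

/-!
# Tao 2016, Theorem 2.3: the named-fact frontier is Matomäki–Radziwiłł–Tao 2015, Proposition A.3

Topic `Literature/NumberTheory/LFunctions`.  Everything in this file is PROVED (a one-line composition of
theorems of the tree); no named facts are introduced.

The named fact `Literature.NumberTheory.LFunctions.Tao2016_theorem23` (T. Tao, Forum Math. Pi 4 (2016)
e8, Theorem 2.3 — the reduced form of the logarithmically averaged nonasymptotic Elliott conjecture,
`TaoLogElliottReduction.lean`) is proved in the tree from its two printed parts
(`Tao2016_theorem23_of_parts`, `TaoLogElliottTheorem23.lean`): the core argument, §2 from (2.10) on and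
§§3–4 (`Tao2016.Tao2016_theorem23_core_holds`, `TaoLogElliottCore.lean`, PROVED), and Proposition 2.4,
whose only remaining named-fact input is Matomäki–Radziwiłł–Tao 2015, Proposition A.3
(Prop. A.3 ⟹ Thm A.2, `MatomakiRadziwillTao2015_theoremA2_of_propA3`, `MatomakiRadziwillTaoPropA3.lean`;
Thm A.2 ⟹ Thm 1.7, `MRT2015.MatomakiRadziwillTao2015_theorem17_of_theoremA2`; Thm 1.7 ⟹ Prop. 2.4,
`Tao2016_prop24_of_MRT`; all proved in the tree, cf. `Tao2016_prop24_of_propA3` in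
`TaoLogElliottProp24OfPropA3.lean`).  Hence the single remaining named-fact input below Theorem 2.3 is
`Literature.NumberTheory.LFunctions.MatomakiRadziwillTao2015_propA3` (the mean value theorem for the
`𝒮`-restricted Dirichlet polynomial of a complex `1`-bounded multiplicative function,
`MatomakiRadziwillTaoPropA3.lean`), and the discharge `Tao2016_theorem23_holds` is the term
`Tao2016_theorem23_of_propA3 MatomakiRadziwillTao2015_propA3_holds` as soon as the latter theorem exists:

* `Tao2016_theorem23_of_propA3 : MatomakiRadziwillTao2015_propA3 → Tao2016_theorem23`.

(`TaoLogChowlaOfTheoremA2.lean` records the analogous compositions for Theorems 1.3 and 1.2, and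
`Tao2016_theorem23_of_theoremA2`.)

## References
* T. Tao, *The logarithmically averaged Chowla and Elliott conjectures for two-point correlations*,
  Forum Math. Pi 4 (2016), e8; arXiv:1509.05422: Theorem 2.3, Proposition 2.4 and the remark following it
  ("Proposition 2.4 is the only way in which we will take advantage of the hypothesis (2.7)").
* K. Matomäki, M. Radziwiłł, T. Tao, *An averaged form of Chowla's conjecture*, Algebra & Number Theory 9
  (2015), 2167–2196; arXiv:1503.05121: Theorem 1.7, Appendix A (Theorem A.2, Proposition A.3).
-/

namespace Literature.NumberTheory.LFunctions

/-- **Tao 2016, Theorem 2.3, from MRT 2015, Proposition A.3**: Theorem A.2 from Prop. A.3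
(`MatomakiRadziwillTao2015_theoremA2_of_propA3`), then Theorem 1.7, Proposition 2.4 and the proved core
of §§2–4 (`Tao2016_theorem23_of_theoremA2` = `Tao2016_theorem23_of_MRT ∘ theorem17_of_theoremA2`, with
`Tao2016.Tao2016_theorem23_core_holds` inside).  This is the whole proof of Theorem 2.3 modulo the single
named fact `MatomakiRadziwillTao2015_propA3`. [cite: TaoFMP2016, Theorem 2.3] -/
theorem Tao2016_theorem23_of_propA3 (hA3 : MatomakiRadziwillTao2015_propA3) : Tao2016_theorem23 :=
  Tao2016_theorem23_of_theoremA2 (MatomakiRadziwillTao2015_theoremA2_of_propA3 hA3)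

end Literature.NumberTheory.LFunctions
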